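import Mathlib
import Summits.NavierStokesRegularity.NavierStokesRegularity.Theses.LandauTail
import Summits.NavierStokesRegularity.NavierStokesRegularity.Theorems.LandauTailLandauTailBlowupLandau
import Summits.NavierStokesRegularity.NavierStokesRegularity.Theorems.LandauTailLandauTailBlowupOneParamLeray
import Summits.NavierStokesRegularity.NavierStokesRegularity.Theorems.LandauTailLandauTailBlowupOsgood
import Literature.Analysis.FluidPDE.ClassicalSolutionCalculus

/-!
# NavierStokesRegularity — route `LandauTail`, crux `LandauTailBlowup`: the one-parameter model in
  Leray's variables, and the Osgood set of a witness

Helper file for the crux item `stmt-NavierStokesRegularity-1944` (`LandauTail.LandauTailBlowup`, line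
`registered`). It composes three landed helper files of the line:

* `LandauTailLandauTailBlowupLandau` (`landauTailLocal_iff_landauSolution`: the singularity model is the
  ONE-PARAMETER Landau model with axis `e₃`, by Šverák's classification and rotation covariance),
* `LandauTailLandauTailBlowupOneParamLeray` (`landauTail_oneParam_iff_backwardLeray`: for each parameter
  `A`, the physical one-parameter model ⇔ a forward-global orbit of Leray's backward system converging
  pointwise off the origin to `landauSolution 1 A`),
* `LandauTailLandauTailBlowupOsgood` (`landauTail_tail_locUnifBdd_dense`: a pointwise parabolic tail of a
  jointly continuous field forces local uniform boundedness of the rescaled family on a dense set),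

into:

* `landauTailLocal_iff_oneParam_backwardLeray` — `LandauTailLocal ⇔ ∃ A > 1`, a classical solution
  `(V, Q)` of the backward Leray system (ν = 1) on `(0, ∞) × ℝ³` with the transported Tsai bounds and
  `V(s, y) → landauSolution 1 A y` (`s → ∞`, every `y ≠ 0`): a forward-global orbit of Leray's system
  converging pointwise to the explicit punctured equilibrium (10.44);
* `landauTailBlowup_iff_oneParam_backwardLeray_and_transfer` — the crux, through the tight cut;
* `landauTail_oneParam_locUnifBdd_dense` — every witness `(A, u, p)` of the one-parameter physical
  model has its rescaled family `{√(−t) u(t, √(−t)·) : t ∈ [−1/2, 0)}` locally uniformly bounded on a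
  dense (open) set of `y` (the Osgood set; its complement, a closed nowhere dense set, is where a
  Type-II core may hide).

References: J. Leray, Acta Math. 63 (1934), (3.11)–(3.12); V. Šverák, arXiv:math/0604550, Thm 1;
P. G. Lemarié-Rieusset (2016), Thm 10.13, (10.44); W. F. Osgood, Amer. J. Math. 19 (1897) (uniform
boundedness on a dense open set via Baire).
-/

noncomputable section

open Filter Set Topology MeasureTheory Metric
open scoped ENNReal NNReal
open Literature.Analysis.FluidPDE

-- the summit-side namespace repeats a component by design (D-0017)
set_option linter.dupNamespace false

namespace Summit.NavierStokesRegularity.NavierStokesRegularity.Theorems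

/-- **The singularity model in Leray's variables, one-parameter form** (registered support stub of
crux stmt-NavierStokesRegularity-1944, line `registered`): `LandauTailLocal` holds iff for some
`A > 1` there is a classical solution `(V, Q)` of the backward Leray system with `ν = 1` on
`(0, ∞) × ℝ³` with `∫_{B_{e^{s/2}}} |V(s)|² ≤ C e^{s/2}`, `∫₀^∞ e^{−s/2} ∫_{B_{e^{s/2}}} |∇V(s)|² ds < ∞`,
converging pointwise off the origin, as `s → ∞`, to Landau's solution `landauSolution 1 A`
(composition of `landauTailLocal_iff_landauSolution` with `landauTail_oneParam_iff_backwardLeray`). [folklore] -/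
theorem landauTailLocal_iff_oneParam_backwardLeray :
    Summit.NavierStokesRegularity.NavierStokesRegularity.Theses.LandauTail.LandauTailLocal ↔ ∃ A : ℝ, 1 < A ∧ ∃ (V : ℝ → EuclideanSpace ℝ (Fin 3) → EuclideanSpace ℝ (Fin 3)) (Q : ℝ → EuclideanSpace ℝ (Fin 3) → ℝ), Literature.Analysis.FluidPDE.IsBackwardLeraySolutionOn (Set.Ioi (0 : ℝ)) 1 V Q ∧ (∃ C : NNReal, ∀ s ∈ Set.Ioi (0 : ℝ), ∫⁻ y in Metric.ball (0 : EuclideanSpace ℝ (Fin 3)) (Real.exp (s / 2)), ‖V s y‖ₑ ^ 2 ≤ C * ENNReal.ofReal (Real.exp (s / 2))) ∧ (∫⁻ s in Set.Ioi (0 : ℝ), ENNReal.ofReal (Real.exp (-s / 2)) * ∫⁻ y in Metric.ball (0 : EuclideanSpace ℝ (Fin 3)) (Real.exp (s / 2)), ENNReal.ofReal (Literature.Analysis.FluidPDE.frobeniusNormSq (fderiv ℝ (V s) y)) < ⊤) ∧ (∀ y : EuclideanSpace ℝ (Fin 3), y ≠ 0 → Filter.Tendsto (fun s : ℝ => V s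 y) Filter.atTop (nhds (Literature.Analysis.FluidPDE.landauSolution 1 A y))) := by
  rw [landauTailLocal_iff_landauSolution]
  constructor
  · rintro ⟨A, hA, hphys⟩
    exact ⟨A, hA, (landauTail_oneParam_iff_backwardLeray A).1 hphys⟩
  · rintro ⟨A, hA, hleray⟩
    exact ⟨A, hA, (landauTail_oneParam_iff_backwardLeray A).2 hleray⟩

/-- **The crux in Leray's variables, one-parameter form**: `LandauTailBlowup` iff (a) for some `A > 1`
there is a forward-global classical orbit of the backward Leray system (ν = 1) on `(0, ∞) × ℝ³` with
the transported Tsai bounds converging pointwise off the origin to `landauSolution 1 A`, and (b) the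
localisation `LandauTailTransfer` (item stmt-NavierStokesRegularity-1948) holds — the tight cut read
through `landauTailLocal_iff_oneParam_backwardLeray`. [folklore] -/
theorem landauTailBlowup_iff_oneParam_backwardLeray_and_transfer :
    Summit.NavierStokesRegularity.NavierStokesRegularity.Theses.LandauTail.LandauTailBlowup ↔
      (∃ A : ℝ, 1 < A ∧ ∃ (V : ℝ → EuclideanSpace ℝ (Fin 3) → EuclideanSpace ℝ (Fin 3))
          (Q : ℝ → EuclideanSpace ℝ (Fin 3) → ℝ),
        IsBackwardLeraySolutionOn (Set.Ioi (0 : ℝ)) 1 V Q ∧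
        (∃ C : ℝ≥0, ∀ s ∈ Set.Ioi (0 : ℝ), ∫⁻ y in ball (0 : EuclideanSpace ℝ (Fin 3)) (Real.exp (s / 2)),
          ‖V s y‖ₑ ^ 2 ≤ C * ENNReal.ofReal (Real.exp (s / 2))) ∧
        (∫⁻ s in Set.Ioi (0 : ℝ), ENNReal.ofReal (Real.exp (-s / 2)) *
          ∫⁻ y in ball (0 : EuclideanSpace ℝ (Fin 3)) (Real.exp (s / 2)),
            ENNReal.ofReal (frobeniusNormSq (fderiv ℝ (V s) y)) < ⊤) ∧
        (∀ y : EuclideanSpace ℝ (Fin 3), y ≠ 0 →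
          Tendsto (fun s : ℝ => V s y) atTop (𝓝 (landauSolution 1 A y)))) ∧
      Summit.NavierStokesRegularity.NavierStokesRegularity.Theses.LandauTail.LandauTailTransfer := by
  rw [landauTailBlowup_iff_local_and_transfer, landauTailLocal_iff_oneParam_backwardLeray]

/-- **The Osgood set of a witness of the one-parameter model**: if `(u, p)` is a classical
unit-viscosity solution on `ℝ³ × (−1, 0)` with the parabolic tail `√(−t) u(t, √(−t) y) → landauSolution 1 A y`
for every `y ≠ 0`, then the set of points `y` around which the rescaled family
`{z ↦ √(−t) u(t, √(−t) z) : t ∈ [−1/2, 0)}` is uniformly bounded is dense (it is open by construction):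
joint smoothness gives joint continuity, and `landauTail_tail_locUnifBdd_dense` applies. [folklore] -/
theorem landauTail_oneParam_locUnifBdd_dense {A : ℝ}
    {u : ℝ → EuclideanSpace ℝ (Fin 3) → EuclideanSpace ℝ (Fin 3)} {p : ℝ → EuclideanSpace ℝ (Fin 3) → ℝ}
    (hcl : IsClassicalNSSolutionOn (Set.Ioo (-1) 0) 1 0 u p)
    (htail : ∀ y : EuclideanSpace ℝ (Fin 3), y ≠ 0 →
      Tendsto (fun t : ℝ => Real.sqrt (0 - t) • u t (Real.sqrt (0 - t) • y)) (𝓝[<] 0)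
        (𝓝 (landauSolution 1 A y))) :
    Dense {y : EuclideanSpace ℝ (Fin 3) | ∃ ρ : ℝ, 0 < ρ ∧ ∃ M : ℝ, ∀ t ∈ Set.Ico (-1/2 : ℝ) 0,
      ∀ z ∈ ball y ρ, ‖Real.sqrt (0 - t) • u t (Real.sqrt (0 - t) • z)‖ ≤ M} :=
  landauTail_tail_locUnifBdd_dense u (landauSolution 1 A) hcl.smooth_velocity.continuousOn htail

end Summit.NavierStokesRegularity.NavierStokesRegularity.Theorems

end
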